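import Literature.NumberTheory.LFunctions.Zhang2022.Section8ProfilePairCalc
import Literature.NumberTheory.LFunctions.Zhang2022.Section8ProfilePairRanges
import Literature.NumberTheory.LFunctions.Zhang2022.Section8ProfilePairBounds
import HarnessLib

/-!
# Zhang (2022) §8 for profile data, BILINEAR version: the jets term and the sliver term of the row (S) for a PAIR of
# `C²` short pieces, each `≤ K·𝓛⁻¹` at a large modulus

Topic `Literature/NumberTheory/LFunctions/Zhang2022` (Landau–Siegel audit tree; verdict-neutral). Y. Zhang, *Discrete mean
estimates and the Landau–Siegel zero*, arXiv:2211.02515v1 (2022) [Zhang2022LandauSiegel] — **an unrefereed manuscript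
under adjudication; nothing here asserts or denies its Theorems 1–2; no claim about Landau–Siegel zeros.** Cell
landau-siegel §D, crux K0 = stmt-Parity-20459 `InClassSideTablesPiece` (line «sjrows»), prover ls-knife-K0-p1 g3.
Two of the five error terms of the bilinear row `Section8ProfilePairRow.sjPairRow_C2` (the other three — good range,
engine, tail — are served by the diagonal lemmas of `Section8ProfileSjTerms` verbatim):

* `jetTerm_pair_le` — `π⁻¹‖∫₀^{θ₀}(Φ − 𝔧_j(u)𝔪(v̄))‖ ≤ K_jet·𝓛⁻¹` (jet gaps of `Section8DipoleJets`, `θ₀ ≤ θ_u, θ_v`);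
* `sliverPair_bound` — `(Λ/π)‖Σ_{P^{θ₀}/T² ≤ n < P^{θ₀}} Σ_{dr=n} w_j M_j[u] N_j[v]‖ ≤ K_S·𝓛⁻¹`, `θ₀ = min(θ_u,θ_v)`, in all three
  cases `θ_u = θ_v` / `θ_u < θ_v` / `θ_v < θ_u` (the shorter piece's sliver lies in the longer piece's good range once
  `τ₁ ≤ |θ_u − θ_v|`).

## References
* Y. Zhang, arXiv:2211.02515v1 (2022), §8 Lemmas 8.2–8.4, (8.10)–(8.12), pp. 47–48. [cite: Zhang2022LandauSiegel, §8 pp.47–48]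
-/

noncomputable section

open Complex Real MeasureTheory Set intervalIntegral Filter Finset
open scoped ComplexConjugate Topology

namespace Literature.NumberTheory.LFunctions.Zhang2022.DipoleRule

open Skeleton KnifeEdge

/-! ### The jets term for a pair -/

/-- **Jets, bilinear:** `π⁻¹‖∫₀^{θ₀}(Φ − 𝔧_j(u)𝔪(v̄))‖ ≤ K_jet·𝓛⁻¹` (`θ₀ ≤ θ_u, θ_v`; the jet gaps of `Section8DipoleJets`).
[cite: Zhang2022LandauSiegel, §2 (2.13); §8 (8.11)–(8.12)] -/
theorem jetTerm_pair_le (c' : ℝ) {D : ℕ} (hL : 3 ≤ Real.log D) {j : ℕ} (hj : j ∈ ({1, 2, 3} : Finset ℕ))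
    {u u' v v' : ℝ → ℂ} {θu θv θ₀ : ℝ} (hθ0 : 0 ≤ θ₀) (h0u : θ₀ ≤ θu) (h0v : θ₀ ≤ θv)
    (hv : ContinuousOn v (Icc 0 θv)) (hvvan : ∀ y : ℝ, θv ≤ y → v y = 0) (hθv1 : θv ≤ 1)
    {B₀ B₁ : ℝ} (hB00 : 0 ≤ B₀) (hB0u : ∀ y ∈ Icc 0 θu, ‖u y‖ ≤ B₀) (hB1u : ∀ y ∈ Icc 0 θu, ‖u' y‖ ≤ B₁)
    (hB0v : ∀ y ∈ Icc 0 θv, ‖v y‖ ≤ B₀) (hB1v : ∀ y ∈ Icc 0 θv, ‖v' y‖ ≤ B₁) :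
    1 / π * ‖∫ z in (0:ℝ)..θ₀, (pairProfile (betaJ c' D j * Real.log D ^ 9) (sigmaJ c' D j) (nuJ c' D j) θv u u' v v' z
        - k0jet j u u' z * k0mass (Repair.bS j) (Repair.bN j) (fun t => conj (v t)) (fun t => conj (v' t)) z)‖
      ≤ (15 * π * |c'| * π * B₀ * (B₁ + 2 * Gbound c' * B₀ + Gbound c' ^ 2 * (B₀ * θv))
          + (B₁ + π * j * B₀) * (30 * π * |c'| * π * B₀
              + 9 * π ^ 2 * (10 * |c'| * π + 25 * c' ^ 2 * π ^ 2) * (B₀ * θv))) * θ₀ / π / Real.log D := by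
  have hℓ0 : 0 < Real.log D := by linarith
  have hℓ1 : 1 ≤ Real.log D := by linarith
  have hℓne : ell D ≠ 0 := hℓ0.ne'
  obtain ⟨-, hαℓ⟩ := alpha_mul_ell9_eq hℓne
  have hαℓ' : alpha D * ell D = π / Real.log D ^ 8 := hαℓ
  have h8 : (1 : ℝ) ≤ Real.log D ^ 8 := one_le_pow₀ hℓ1
  have hx : alpha D * ell D ≤ π / Real.log D := by
    rw [hαℓ']
    apply div_le_div_of_nonneg_left Real.pi_pos.le hℓ0
    calc Real.log D = Real.log D ^ 1 := (pow_one _).symm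
      _ ≤ Real.log D ^ 8 := pow_le_pow_right₀ hℓ1 (by norm_num)
  have hx0 : 0 ≤ alpha D * ell D := by rw [hαℓ']; positivity
  have hx2 : (alpha D * ell D) ^ 2 ≤ π ^ 2 / Real.log D := by
    have : (alpha D * ell D) ^ 2 ≤ (alpha D * ell D) * π := by
      have hle1 : alpha D * ell D ≤ π := by
        rw [hαℓ']; exact div_le_self Real.pi_pos.le h8
      nlinarith
    calc (alpha D * ell D) ^ 2 ≤ (alpha D * ell D) * π := this
      _ ≤ π / Real.log D * π := mul_le_mul_of_nonneg_right hx Real.pi_pos.le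
      _ = π ^ 2 / Real.log D := by ring
  have hJgap : ∀ y ∈ Icc 0 θu, ‖jetEx (betaJ c' D j * Real.log D ^ 9) u u' y - k0jet j u u' y‖
      ≤ 15 * π * |c'| * π * B₀ / Real.log D := by
    intro y hy
    have h := norm_jet_sub_k0jet_le c' hℓne hj u u' y
    have e : jetEx (betaJ c' D j * Real.log D ^ 9) u u' y = betaJ c' D j * ((ell D ^ 9 : ℝ) : ℂ) * u y + u' y := by
      unfold jetEx ell; push_cast; ring
    rw [e]
    refine h.trans ?_
    calc 15 * π * |c'| * (alpha D * ell D) * ‖u y‖ ≤ 15 * π * |c'| * (π / Real.log D) * B₀ := by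
          gcongr; exact hB0u y hy
      _ = 15 * π * |c'| * π * B₀ / Real.log D := by ring
  have hσ : ‖sigmaJ c' D j - I * π * ((Repair.bS j : ℝ) : ℂ)‖ ≤ 30 * π * |c'| * π / Real.log D := by
    have h := norm_betaSum_mul_sub_le c' hℓne hj
    have e : sigmaJ c' D j = (betaJ c' D (j + 1) + betaJ c' D (j + 2)) * ((ell D ^ 9 : ℝ) : ℂ) := rfl
    rw [e]
    refine h.trans ?_
    calc 30 * π * |c'| * (alpha D * ell D) ≤ 30 * π * |c'| * (π / Real.log D) := by gcongr
      _ = _ := by ring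
  have hν : ‖nuJ c' D j + (π : ℂ) ^ 2 * ((Repair.bN j : ℝ) : ℂ)‖
      ≤ 9 * π ^ 2 * (10 * |c'| * π + 25 * c' ^ 2 * π ^ 2) / Real.log D := by
    have h := norm_betaProd_mul_add_le c' hℓne hj
    have e : nuJ c' D j = betaJ c' D (j + 1) * ((ell D ^ 9 : ℝ) : ℂ) * (betaJ c' D (j + 2) * ((ell D ^ 9 : ℝ) : ℂ)) := rfl
    rw [e]
    refine h.trans ?_
    have h1 : 10 * |c'| * (alpha D * ell D) + 25 * c' ^ 2 * (alpha D * ell D) ^ 2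
        ≤ (10 * |c'| * π + 25 * c' ^ 2 * π ^ 2) / Real.log D := by
      rw [add_div]
      refine add_le_add ?_ ?_
      · calc 10 * |c'| * (alpha D * ell D) ≤ 10 * |c'| * (π / Real.log D) := by gcongr
          _ = _ := by ring
      · calc 25 * c' ^ 2 * (alpha D * ell D) ^ 2 ≤ 25 * c' ^ 2 * (π ^ 2 / Real.log D) := by gcongr
          _ = _ := by ring
    calc 9 * π ^ 2 * (10 * |c'| * (alpha D * ell D) + 25 * c' ^ 2 * (alpha D * ell D) ^ 2)
        ≤ 9 * π ^ 2 * ((10 * |c'| * π + 25 * c' ^ 2 * π ^ 2) / Real.log D) := by gcongr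
      _ = _ := by ring
  have key := norm_integral_pairProfile_sub_k0_le (γ := betaJ c' D j * Real.log D ^ 9) (σ := sigmaJ c' D j)
    (ν := nuJ c' D j) (j := j) (s := Repair.bS j) (N := Repair.bN j) hθ0 h0u h0v hv hvvan hθv1 hB0u hB1u hB0v hB1v
    hJgap hσ hν
  have hK : B₁ + ‖sigmaJ c' D j‖ * B₀ + ‖nuJ c' D j‖ * (B₀ * θv) ≤ B₁ + 2 * Gbound c' * B₀ + Gbound c' ^ 2 * (B₀ * θv) := by
    have h1 := norm_sigmaJ_le c' hL j
    have h2 := norm_nuJ_le c' hL j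
    have hθv0 : 0 ≤ θv := hθ0.trans h0v
    gcongr
  have hB10 : 0 ≤ B₁ := by
    have := hB1v 0 ⟨le_rfl, hθ0.trans h0v⟩; exact (norm_nonneg _).trans this
  have hθv0 : 0 ≤ θv := hθ0.trans h0v
  have hJk0 : 0 ≤ B₁ + π * j * B₀ := by positivity
  have hεJ0 : 0 ≤ 15 * π * |c'| * π * B₀ / Real.log D := by positivity
  rw [one_div, inv_mul_le_iff₀ Real.pi_pos]
  refine key.trans ?_
  have e : π * ((15 * π * |c'| * π * B₀ * (B₁ + 2 * Gbound c' * B₀ + Gbound c' ^ 2 * (B₀ * θv))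
      + (B₁ + π * j * B₀) * (30 * π * |c'| * π * B₀
          + 9 * π ^ 2 * (10 * |c'| * π + 25 * c' ^ 2 * π ^ 2) * (B₀ * θv))) * θ₀ / π / Real.log D)
      = (15 * π * |c'| * π * B₀ / Real.log D * (B₁ + 2 * Gbound c' * B₀ + Gbound c' ^ 2 * (B₀ * θv))
          + (B₁ + π * j * B₀) * (30 * π * |c'| * π / Real.log D * B₀
            + 9 * π ^ 2 * (10 * |c'| * π + 25 * c' ^ 2 * π ^ 2) / Real.log D * (B₀ * θv))) * θ₀ := by
    field_simp
  rw [e]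
  gcongr


/-! ### The sliver for a pair, all three cases -/

set_option maxHeartbeats 800000 in
/-- **THE SLIVER FOR A PAIR, `×Λ/π`, `≤ K_S·𝓛⁻¹` in all three cases** (`θ₀ = min(θ_u,θ_v)`; the range
`[⌈e^{(θ₀−τ₁)Λ}⌉, ⌈e^{θ₀Λ}⌉)`): `θ_u = θ_v` — both inner sums crude-small (`sliver_term_pair_crude`, `sliverTotal_le`);
`θ_u < θ_v` — `M_j[u]` crude-small, `N_j[v]` of main size since `τ₁ ≤ θ_v − θ_u` (`sliver_term_pair_psiCrude`,
`sliverPairB_total_le`); `θ_v < θ_u` — symmetrically (`sliver_term_pair_antiCrude`, `sliverPairC_total_le`). The constant is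
the sum of the three case constants. [cite: Zhang2022LandauSiegel, §8 Lemmas 8.2–8.4, display before (8.10), p.47] -/
theorem sliverPair_bound (c' : ℝ) {D : ℕ} [NeZero D] (χ : DirichletCharacter ℂ D) (hq : χ.IsQuadratic)
    (hprim : χ.IsPrimitive) (j : ℕ) (hL : 3 ≤ Real.log D) (hA : ‖χ.LFunction 1‖ ≤ 1 / Real.log D ^ 2022)
    {u u' u'' v v' v'' : ℝ → ℂ} {θu θv θ₀ : ℝ} (hmin : θ₀ = min θu θv) (hθu1 : θu < 1) (hθv1 : θv < 1)
    (hu : ContinuousOn u (Icc 0 θu)) (hu' : ContinuousOn u' (Icc 0 θu)) (hu'' : ContinuousOn u'' (Icc 0 θu))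
    (hdu : ∀ y ∈ Ioo 0 θu, HasDerivWithinAt u (u' y) (Ioi y) y)
    (hdu' : ∀ y ∈ Ioo 0 θu, HasDerivWithinAt u' (u'' y) (Ioi y) y) (huvan : ∀ y : ℝ, θu ≤ y → u y = 0)
    (hv : ContinuousOn v (Icc 0 θv)) (hv' : ContinuousOn v' (Icc 0 θv)) (hv'' : ContinuousOn v'' (Icc 0 θv))
    (hdv : ∀ y ∈ Ioo 0 θv, HasDerivWithinAt v (v' y) (Ioi y) y)
    (hdv' : ∀ y ∈ Ioo 0 θv, HasDerivWithinAt v' (v'' y) (Ioi y) y) (hvvan : ∀ y : ℝ, θv ≤ y → v y = 0)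
    {B₀ B₁ B₂ : ℝ} (hB00 : 0 ≤ B₀) (hB10 : 0 ≤ B₁) (hB20 : 0 ≤ B₂)
    (hB0u : ∀ y ∈ Icc 0 θu, ‖u y‖ ≤ B₀) (hB1u : ∀ y ∈ Icc 0 θu, ‖u' y‖ ≤ B₁) (hB2u : ∀ y ∈ Icc 0 θu, ‖u'' y‖ ≤ B₂)
    (hB0v : ∀ y ∈ Icc 0 θv, ‖v y‖ ≤ B₀) (hB1v : ∀ y ∈ Icc 0 θv, ‖v' y‖ ≤ B₁) (hB2v : ∀ y ∈ Icc 0 θv, ‖v'' y‖ ≤ B₂)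
    (hBuz : ∀ z ∈ Icc 0 θu, ‖u z‖ ≤ B₁ * (θu - z)) (hBvz : ∀ z ∈ Icc 0 θv, ‖v z‖ ≤ B₁ * (θv - z))
    (hθuN : Real.exp (θu * Real.log D ^ 9) < Nsupp D) (hθvN : Real.exp (θv * Real.log D ^ 9) < Nsupp D)
    (hY1 : 1 ≤ Real.exp ((θ₀ - 2 * Real.log D ^ (11 / 10 : ℝ) / Real.log D ^ 9) * Real.log D ^ 9))
    (hgapB : θu < θv → 2 * Real.log D ^ (11 / 10 : ℝ) / Real.log D ^ 9 ≤ θv - θu)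
    (hgapC : θv < θu → Real.log D ^ (11 / 10 : ℝ) / Real.log D ^ 9 ≤ θu - θv)
    {C₈₄ Cξ : ℝ} (hC84 : 0 ≤ C₈₄) (hCξ : 0 ≤ Cξ)
    (h84 : ∀ d r : ℕ, 1 ≤ d → 1 ≤ r → ((d * r : ℕ) : ℝ) ≤ Real.exp (θ₀ * Real.log D ^ 9) →
      ∀ y : ℝ, bigT D < y → y < bigP D →
        ‖(∑ n ∈ Finset.Ico 1 ⌈y⌉₊, χ (n : ZMod D) * xiZero c' D j n d r / (n : ℂ) *
              ((y / n : ℝ) : ℂ) ^ (-betaMu D 6) * (Real.log (y / n) : ℂ)) -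
            deriv χ.LFunction 1 * PiW χ d r * frakgW c' D j 6 y‖
          ≤ C₈₄ * (Real.log D ^ 6)⁻¹ * (∏ q ∈ (d * r).primeFactors, (1 - (q : ℝ)⁻¹)⁻¹) ^ 2)
    (hΞ : ∀ d r : ℕ, ∀ y : ℝ, 1 ≤ y →
      y ≤ Real.exp (2 * Real.log D ^ (11 / 10 : ℝ) / Real.log D ^ 9 * Real.log D ^ 9) →
      ∑ n ∈ Finset.Ico 1 ⌈y⌉₊, ‖xiZero c' D j n d r‖ / n ≤ Cξ * (1 + 2 * Real.log D ^ (11 / 10 : ℝ)) ^ 3) :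
    Real.log D ^ 9 / π * ‖∑ n ∈ Finset.Ico
        ⌈Real.exp ((θ₀ - 2 * Real.log D ^ (11 / 10 : ℝ) / Real.log D ^ 9) * Real.log D ^ 9)⌉₊
        ⌈Real.exp (θ₀ * Real.log D ^ 9)⌉₊,
        ∑ p ∈ Nat.divisorsAntidiagonal n, sjWeight c' χ j p * (psiSum c' D χ j u n * antiSum c' D χ j v p.1 p.2)‖
      ≤ (8 * 3 ^ 5 * Real.exp 430 / π * B₁ ^ 2 * Cξ
          + 36 * Real.exp 430 / π * B₁ *
              (4 * Real.exp (9 / 2) * (B₁ + 2 * Gbound c' * B₀ + Gbound c' ^ 2 * (B₀ * θv))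
                + (C₈₄ * ((1 + (3 * π / 2 + 1) ^ 2) * (B₀ + B₁ + B₂))
                  + 2 * ((3 * π / 2 + 1) ^ 2 * (B₀ + B₁ + B₂))
                    * (108 * Cξ + 4 * Real.exp (9 / 2) *
                      (1 + 2 * (Gbound c' ^ 2 / (3 * π / 2) ^ 2) + 2 * ((Gbound c' + 3 * π / 2) ^ 2 / (3 * π / 2))))))
          + 324 * Real.exp 430 / π * B₁ * Cξ *
              (4 * Real.exp (9 / 2) * (Gbound c' * B₀ + B₁)
                + (Lemma82.C82 0 * ((Gbound c' + 1) ^ 2 * (B₀ + B₁ + B₂))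
                  + (Gbound c' + 1) ^ 2 * (B₀ + B₁ + B₂) * (2 + 4 * Real.exp (9 / 2)))))
        / Real.log D := by
  -- names and constants
  set ℓ : ℝ := Real.log D with hℓdef
  set Λ : ℝ := Real.log D ^ 9 with hΛ
  set L₁ : ℝ := Real.log D ^ (11 / 10 : ℝ) with hL₁
  set G := Gbound c' with hGdef
  set KN' : ℝ := C₈₄ * ((1 + (3 * π / 2 + 1) ^ 2) * (B₀ + B₁ + B₂))
      + 2 * ((3 * π / 2 + 1) ^ 2 * (B₀ + B₁ + B₂))
        * (108 * Cξ + 4 * Real.exp (9 / 2) *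
          (1 + 2 * (G ^ 2 / (3 * π / 2) ^ 2) + 2 * ((G + 3 * π / 2) ^ 2 / (3 * π / 2)))) with hKN'
  set KM' : ℝ := Lemma82.C82 0 * ((G + 1) ^ 2 * (B₀ + B₁ + B₂))
      + (G + 1) ^ 2 * (B₀ + B₁ + B₂) * (2 + 4 * Real.exp (9 / 2)) with hKM'
  set KA : ℝ := 8 * 3 ^ 5 * Real.exp 430 / π * B₁ ^ 2 * Cξ with hKA
  set KB : ℝ := 36 * Real.exp 430 / π * B₁ * (4 * Real.exp (9 / 2) * (B₁ + 2 * G * B₀ + G ^ 2 * (B₀ * θv)) + KN')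
    with hKB
  set KC : ℝ := 324 * Real.exp 430 / π * B₁ * Cξ * (4 * Real.exp (9 / 2) * (G * B₀ + B₁) + KM') with hKC
  have hℓ0 : 0 < ℓ := by rw [hℓdef]; linarith
  have hℓ1 : 1 ≤ ℓ := by rw [hℓdef]; linarith
  have hΛ0 : 0 < Λ := by positivity
  have hL1pos : 0 < L₁ := Real.rpow_pos_of_pos hℓ0 _
  have hτ0 : 0 ≤ 2 * L₁ / Λ := by positivity
  have hG0 : 0 ≤ G := (Gbound_pos c').le
  have hC820 : 0 ≤ Lemma82.C82 0 := by
    unfold Lemma82.C82; have := Lemma82.I0_nonneg; positivity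
  have h0u : θ₀ ≤ θu := hmin ▸ min_le_left _ _
  have h0v : θ₀ ≤ θv := hmin ▸ min_le_right _ _
  -- `Y ≥ 1` forces `θ₀ ≥ τ₁ ≥ 0`, hence `θ_v ≥ 0`
  have hθv0 : 0 ≤ θv := by
    have h1 : Real.exp 0 ≤ Real.exp ((θ₀ - 2 * L₁ / Λ) * Λ) := by rw [Real.exp_zero]; exact hY1
    have h2 : 0 ≤ (θ₀ - 2 * L₁ / Λ) * Λ := Real.exp_le_exp.mp h1
    have h3 : 0 ≤ θ₀ - 2 * L₁ / Λ :=
      by_contra fun h => by have := mul_neg_of_neg_of_pos (not_le.mp h) hΛ0; linarith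
    linarith
  have hKN0 : 0 ≤ KN' := by positivity
  have hKM0 : 0 ≤ KM' := by positivity
  have hKA0 : 0 ≤ KA := by positivity
  have hKB0 : 0 ≤ KB := by positivity
  have hKC0 : 0 ≤ KC := by positivity
  have hYX : Real.exp ((θ₀ - 2 * L₁ / Λ) * Λ) ≤ Real.exp (θ₀ * Λ) := by
    rw [Real.exp_le_exp, sub_mul]
    linarith only [mul_nonneg hτ0 hΛ0.le]
  have hΞ0 : 0 ≤ Cξ * (1 + 2 * L₁) ^ 3 := by positivity
  have hL' : ‖deriv χ.LFunction 1‖ ≤ 4 * Real.exp (9 / 2) * Real.log D ^ 2 :=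
    Section8FrontEnd44Sizes.norm_deriv_LFunction_one_le χ hprim hL
  have hL'0 : 0 ≤ ‖deriv χ.LFunction 1‖ := norm_nonneg _
  -- it suffices to bound by one of the three case constants
  suffices hcase : Real.log D ^ 9 / π * ‖∑ n ∈ Finset.Ico ⌈Real.exp ((θ₀ - 2 * L₁ / Λ) * Λ)⌉₊ ⌈Real.exp (θ₀ * Λ)⌉₊,
        ∑ p ∈ Nat.divisorsAntidiagonal n, sjWeight c' χ j p * (psiSum c' D χ j u n * antiSum c' D χ j v p.1 p.2)‖
      ≤ KA / ℓ ∨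
    Real.log D ^ 9 / π * ‖∑ n ∈ Finset.Ico ⌈Real.exp ((θ₀ - 2 * L₁ / Λ) * Λ)⌉₊ ⌈Real.exp (θ₀ * Λ)⌉₊,
        ∑ p ∈ Nat.divisorsAntidiagonal n, sjWeight c' χ j p * (psiSum c' D χ j u n * antiSum c' D χ j v p.1 p.2)‖
      ≤ KB / ℓ ∨
    Real.log D ^ 9 / π * ‖∑ n ∈ Finset.Ico ⌈Real.exp ((θ₀ - 2 * L₁ / Λ) * Λ)⌉₊ ⌈Real.exp (θ₀ * Λ)⌉₊,
        ∑ p ∈ Nat.divisorsAntidiagonal n, sjWeight c' χ j p * (psiSum c' D χ j u n * antiSum c' D χ j v p.1 p.2)‖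
      ≤ KC / ℓ by
    have hsum : KA / ℓ ≤ (KA + KB + KC) / ℓ ∧ KB / ℓ ≤ (KA + KB + KC) / ℓ ∧ KC / ℓ ≤ (KA + KB + KC) / ℓ := by
      refine ⟨?_, ?_, ?_⟩ <;> exact div_le_div_of_nonneg_right (by linarith) hℓ0.le
    rcases hcase with h | h | h
    · exact h.trans hsum.1
    · exact h.trans hsum.2.1
    · exact h.trans hsum.2.2
  rcases lt_trichotomy θu θv with hlt | heq | hgt
  · -- case `θ_u < θ_v`: `θ₀ = θ_u`
    right; left
    have h0 : θ₀ = θu := by rw [hmin, min_eq_left hlt.le]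
    rw [h0] at hY1 hYX h84 ⊢
    have hgap := hgapB hlt
    set E : ℝ := (B₁ * (2 * L₁ / Λ) * (1 + 2 * L₁ / Λ * Λ))
        * (Λ⁻¹ * (‖deriv χ.LFunction 1‖ * antiK0 c' D j B₀ B₁ θv
            + deltaN0 c' D j B₀ B₁ B₂ C₈₄ (Cξ * (1 + 2 * L₁) ^ 3) ‖deriv χ.LFunction 1‖)) with hE
    have hK0 : 0 ≤ antiK0 c' D j B₀ B₁ θv := by unfold antiK0; positivity
    have hdN0 : 0 ≤ deltaN0 c' D j B₀ B₁ B₂ C₈₄ (Cξ * (1 + 2 * L₁) ^ 3) ‖deriv χ.LFunction 1‖ := by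
      unfold deltaN0; positivity
    have hE0 : 0 ≤ E := by positivity
    have hsl := sliver_range_bound_of c' χ j u v hY1 hYX hE0 ?_
    · refine sliverPairB_total_le (θ := θu) hL hB10 hK0 ?_ hdN0 ?_ hL'0 hL' hsl
      · unfold antiK0
        have h1 := norm_sigmaJ_le c' hL j
        have h2 := norm_nuJ_le c' hL j
        gcongr
      · exact deltaN0_le c' hL j hB00 hB10 hB20 hC84 hCξ hL'0 hL'
    · intro d r hd hr hnY hnX
      have h := sliver_term_pair_psiCrude χ hq c' j hL hθv1 huvan hBuz hv hv' hv'' hdv hdv' hvvan hB00 hB10 hB20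
        hB0v hB1v hB2v hθuN hθvN hgap hd hr hnY hnX (C₈₄ := C₈₄) (Ξ := Cξ * (1 + 2 * L₁) ^ 3)
        (h84 d r hd hr hnX) (hΞ d r)
      rw [hE]
      exact h
  · -- case `θ_u = θ_v = θ₀`
    left
    have h0 : θ₀ = θu := by rw [hmin, heq, min_self]
    rw [h0] at hY1 hYX h84 ⊢
    have hvvan' : ∀ y : ℝ, θu ≤ y → v y = 0 := fun y hy => hvvan y (heq ▸ hy)
    have hBvz' : ∀ z ∈ Icc 0 θu, ‖v z‖ ≤ B₁ * (θu - z) := fun z hz => by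
      have := hBvz z (heq ▸ hz); rwa [← heq] at this
    set E : ℝ := B₁ ^ 2 * (2 * L₁ / Λ) ^ 2 * (1 + 2 * L₁ / Λ * Λ) * (Cξ * (1 + 2 * L₁) ^ 3) with hE
    have hE0 : 0 ≤ E := by positivity
    have hsl := sliver_range_bound_of c' χ j u v hY1 hYX hE0 ?_
    · exact sliverTerm_le (θ := θu) hL hCξ hsl
    · intro d r hd hr hnY hnX
      have h := sliver_term_pair_crude χ hq c' j huvan hBuz hvvan' hBvz' hB10 hℓ0 hθuN hd hr hnY hnX
        (Ξ := Cξ * (1 + 2 * L₁) ^ 3) (hΞ d r)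
      refine h.trans ?_
      rw [hE]
      have hrel1 : 1 ≤ (∏ q ∈ (d * r).primeFactors, (1 - (q : ℝ)⁻¹)⁻¹) ^ 2 :=
        Section8FrontEnd44ReductionRel.one_le_relFac (d * r)
      have hR : 1 ≤ (∏ q ∈ (d * r).primeFactors, (1 - (q : ℝ)⁻¹)⁻¹) ^ 2 * (1 + ‖PiW χ d r‖) :=
        one_le_mul_of_one_le_of_one_le hrel1 (by linarith [norm_nonneg (PiW χ d r)])
      exact le_mul_of_one_le_right hE0 hR
  · -- case `θ_v < θ_u`: `θ₀ = θ_v`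
    right; right
    have h0 : θ₀ = θv := by rw [hmin, min_eq_right hgt.le]
    rw [h0] at hY1 hYX h84 ⊢
    have hgap := hgapC hgt
    set E : ℝ := (Λ⁻¹ * (‖deriv χ.LFunction 1‖ * psiJ0 c' D j B₀ B₁ + deltaM0 c' D j B₀ B₁ B₂ ‖deriv χ.LFunction 1‖))
        * (B₁ * (2 * L₁ / Λ) * (Cξ * (1 + 2 * L₁) ^ 3)) with hE
    have hJ0 : 0 ≤ psiJ0 c' D j B₀ B₁ := by unfold psiJ0; positivity
    have hdM0 : 0 ≤ deltaM0 c' D j B₀ B₁ B₂ ‖deriv χ.LFunction 1‖ := by unfold deltaM0; positivity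
    have hE0 : 0 ≤ E := by positivity
    have hsl := sliver_range_bound_of c' χ j u v hY1 hYX hE0 ?_
    · refine sliverPairC_total_le (θ := θv) hL hB10 hCξ hJ0 ?_ hdM0 ?_ hL'0 hL' hsl
      · unfold psiJ0
        have h1 := norm_betaJ_mul_le c' hL j
        gcongr
      · exact deltaM0_le c' hL j hB00 hB10 hB20 hL'0 hL'
    · intro d r hd hr hnY hnX
      have h := sliver_term_pair_antiCrude χ hq c' j hprim hL hA hθu1.le hu hu' hu'' hdu hdu' huvan hB00 hB10 hB20
        hB0u hB1u hB2u hvvan hBvz hθuN hθvN hgap hd hr hnY hnX (Ξ := Cξ * (1 + 2 * L₁) ^ 3) (hΞ d r)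
      refine h.trans ?_
      rw [hE]
      have hrel1 : 1 ≤ (∏ q ∈ (d * r).primeFactors, (1 - (q : ℝ)⁻¹)⁻¹) ^ 2 :=
        Section8FrontEnd44ReductionRel.one_le_relFac (d * r)
      have hR : 1 ≤ (∏ q ∈ (d * r).primeFactors, (1 - (q : ℝ)⁻¹)⁻¹) ^ 2 * (1 + ‖PiW χ d r‖) :=
        one_le_mul_of_one_le_of_one_le hrel1 (by linarith [norm_nonneg (PiW χ d r)])
      exact le_mul_of_one_le_right hE0 hR


end Literature.NumberTheory.LFunctions.Zhang2022.DipoleRule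

end
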